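/-
Copyright (c) 2026. All rights reserved.
Released under Apache 2.0 license as described in the file LICENSE.
Authors: abc-iut cell, seat abc-iut-L4-t14 (gen 2; GAP row G-w5d226-1, proof-only companion: the
model hypothesis `IsIdRigid EA` DISCHARGED at the Aut-holomorphic disc).
-/
import Literature.AnabelianGeometry.AbsoluteAnabelian.ArchimedeanHolFieldFunctorGeometric
import Literature.AnabelianGeometry.AbsoluteAnabelian.AutHolomorphicSpacesTransportProofs
import HarnessLib

/-!
# The geometric `EA` on the Aut-holomorphic disc is id-rigid; Cor 4.5 / Prop 4.2 (i) there, unconditionally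

S. Mochizuki, *Topics in absolute anabelian geometry III*, Prop 4.2 (i) p. 105 ("the categories `EA`,
`𝒞^hol_T = 𝒞̲^hol_T` … are id-rigid"), Cor 4.5 pp. 107–109, Def 2.1 (i) p. 50 (the Aut-holomorphic
disc); kurims manuscript `paper:url-5493eb38cbb7`; bib key `MochizukiAbsTopIII2015`.  PROOF-ONLY
companion (no new notion) of `ArchimedeanHolFieldFunctorGeometric.lean`.

The model theorems over the holomorphic geometric instance `HolRS.geometricAutHolFieldFunctor Q`
(`HolRS.cor_4_5_geometric`, `HolRS.isIdRigid_pairs_of_isIdRigid_EA`) carry ONE hypothesis,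
`IsIdRigid EA^hol_RS(Q)` — in print a consequence of Lemma 4.3 (slimness) for elliptically admissible
hyperbolic orbicurves (campaign-L).  Here it is DISCHARGED at the simplest hyperbolic geometric object,
the open unit disc `𝔻` (the Aut-holomorphic disc of Def 2.1 (i), the universal covering of every
hyperbolic Riemann surface, Cor 2.4), i.e. for `Q = (· = HolRS.disc)`, by the automorphisms of `𝔻`
alone: a holomorphic finite étale self-map `g` of `𝔻` commuting with every rotation fixes `0`
(`g 0 = -g 0` from `z ↦ -z`), and commuting with the Möbius involution `φ_a` exchanging `0` and `a`
(abc-iut-L4-t7's `discMobius`, `discMobius_eq_zero_iff`) gives `g a = a`.  No classification of the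
self-maps of `𝔻` and no slimness is used; print's route (Lemma 4.3) is abc-iut-L4-t10's Galois-category
instance.  HONEST SCOPE: `𝔻` is not an algebraic curve, so this is a sanity instance of the MODEL, not
a case of print's `EA`; general hyperbolic `Q` stays campaign-L.

* `HolRS.disc` — `𝔻` as a connected Riemann surface (carrier `unitDiscOpens`); `HolRS.discHom` — a disc
  automorphism (abc-iut-L4-t7's `IsDiscAut`, transported by `AutHolomorphicSpacesTransportProofs`) as a
  morphism `disc ⟶ disc` of `HolRS`;
* `HolRS.eq_id_of_comm_discAut` — a self-map of `𝔻` commuting with all rotations and all `φ_a` is `id`;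
* `HolRS.app_eq_id_of_obj_eq_disc` (component lemma, any `Q ∋ 𝔻`) and
  `HolRS.isIdRigid_EA_disc` — **`IsIdRigid (geometricAutHolFieldFunctor (· = disc)).EA`**;
* `HolRS.cor_4_5_geometric_disc`, `HolRS.isIdRigid_pairs_disc` — Cor 4.5 (i)–(v) and the Prop 4.2 (i)
  id-rigidity of `𝒞^hol_TF`, `𝒞^hol_T` over the disc, UNCONDITIONALLY.

Refereed pre-IUT anabelian geometry; nothing here bears on [IUTchIII] Cor. 3.12 or takes a side;
model ≠ reconstruction.
-/

set_option autoImplicit false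

noncomputable section

namespace Literature.AnabelianGeometry.AbsoluteAnabelian

open _root_.CategoryTheory _root_.Topology _root_.TopologicalSpace _root_.Set _root_.Metric
open scoped _root_.Manifold _root_.ContDiff
open Literature.Analysis.Complex _root_.Complex

namespace HolRS

/-! ### The disc as an object; disc automorphisms as morphisms -/

/-- **The open unit disc `𝔻` as a connected Riemann surface** (the Aut-holomorphic disc of Def 2.1 (i);
carrier abc-iut-L4-t2's `unitDiscOpens`). [cite: MochizukiAbsTopIII2015, Definition 2.1 (i) p.50] -/
def disc : HolRS :=
  ofOpen unitDiscOpens ((convex_ball (0 : ℂ) 1).isConnected ⟨0, mem_ball_self one_pos⟩)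

/-- The restriction to `𝔻` of a self-map of `ℂ` preserving `𝔻` (the carrier of `disc` is `unitDiscOpens`).
[cite: MochizukiAbsTopIII2015, Definition 2.1 (i) p.50] -/
def discMap (f : ℂ → ℂ) (hf : MapsTo f (ball 0 1) (ball 0 1)) : unitDiscOpens → unitDiscOpens :=
  fun z => ⟨f z, hf (coe_mem_ball z)⟩

/-- Value of the restricted map. [cite: MochizukiAbsTopIII2015, Definition 2.1 (i) p.50] -/
@[simp] theorem discMap_coe (f : ℂ → ℂ) (hf : MapsTo f (ball 0 1) (ball 0 1)) (z : unitDiscOpens) :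
    (discMap f hf z : ℂ) = f z := rfl

/-- **A disc automorphism as a morphism `𝔻 ⟶ 𝔻` of `HolRS`**: holomorphic by abc-iut-L4-t7's
`mdifferentiable_of_differentiableOn`, finite étale because it is a homeomorphism of `𝔻`
(`exists_homeomorph_unitDiscOpens_of_isDiscAut`, `IsFiniteEtale.of_homeomorph`).
[cite: MochizukiAbsTopIII2015, Definition 2.1 (i) p.50] -/
def discHom {f : ℂ → ℂ} (hf : IsDiscAut f) : disc ⟶ disc :=
  ⟨discMap f hf.mapsTo, mdifferentiable_of_differentiableOn hf.differentiableOn fun _ => rfl, by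
    obtain ⟨T, -, -, hT, -⟩ := exists_homeomorph_unitDiscOpens_of_isDiscAut hf
    have h : (⇑T) = discMap f hf.mapsTo := funext fun x => Subtype.ext (hT x)
    exact h ▸ IsFiniteEtale.of_homeomorph T⟩

/-- The underlying map of `discHom hf` is the restriction of `f`. [cite: MochizukiAbsTopIII2015, Definition 2.1 (i) p.50] -/
theorem discHom_toFun {f : ℂ → ℂ} (hf : IsDiscAut f) : (discHom hf).toFun = discMap f hf.mapsTo := rfl

/-! ### A self-map of `𝔻` commuting with the automorphisms is the identity -/

/-- `z ↦ -z` preserves the disc. [cite: MochizukiAbsTopIII2015, Definition 2.1 (i) p.50] -/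
theorem mapsTo_neg_ball : MapsTo (fun w : ℂ => -w) (ball 0 1) (ball 0 1) := fun w hw => by
  simpa using hw

/-- **Rigidity from the automorphisms of the disc**: a self-map `g` of `𝔻` commuting with the rotation
`z ↦ -z` and with every Möbius involution `φ_a(z) = (z - a)/(1 - ā z)`, `a ∈ 𝔻`, is the identity
(`g 0 = -g 0` forces `g 0 = 0`; then `φ_a (g a) = g (φ_a a) = g 0 = 0` forces `g a = a`).
[cite: MochizukiAbsTopIII2015, Proposition 4.2 (i) p.105] -/
theorem eq_id_of_comm_discAut (g : unitDiscOpens → unitDiscOpens)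
    (hneg : ∀ z : unitDiscOpens, (g (discMap (fun w => -w) mapsTo_neg_ball z) : ℂ) = -(g z : ℂ))
    (hmob : ∀ (a : ℂ) (ha : ‖a‖ < 1) (z : unitDiscOpens),
      (g (discMap (discMobius a) (mapsTo_discMobius ha) z) : ℂ) = discMobius a (g z : ℂ)) :
    g = id := by
  -- the centre: `g 0 = 0`
  let o : unitDiscOpens := ⟨0, mem_ball_self one_pos⟩
  have hneg0 : discMap (fun w => -w) mapsTo_neg_ball o = o := Subtype.ext (by simp [o])
  have hg0 : (g o : ℂ) = 0 := by
    have h := hneg o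
    rw [hneg0] at h
    have h2 : (2 : ℂ) * (g o : ℂ) = 0 := by linear_combination h
    simpa using h2
  funext z
  -- `φ_z z = 0`, so `φ_z (g z) = g (φ_z z) = g 0 = 0`, so `g z = z`
  have hz : ‖(z : ℂ)‖ < 1 := norm_coe_lt_one z
  have hmz : discMap (discMobius (z : ℂ)) (mapsTo_discMobius hz) z = o :=
    Subtype.ext (by simp [o])
  have h := hmob (z : ℂ) hz z
  rw [hmz, hg0] at h
  exact Subtype.ext ((discMobius_eq_zero_iff hz (norm_coe_lt_one (g z)).le).1 h.symm)

/-! ### Id-rigidity of the geometric `EA` on the disc; the model theorems there, unconditionally -/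

/-- **The component at the disc of any automorphism of `𝟭` is the identity** — for an ARBITRARY object
property `Q` admitting `𝔻` (the shape abc-iut-L4-t10 uses for `ℂ`, `ℂˣ`, so that id-rigidity assembles for
every `Q ⊆ {ℂ, ℂˣ, 𝔻}`): naturality at the endomorphisms `discHom` (rotation `z ↦ -z`, Möbius involutions
`φ_a`) and `eq_id_of_comm_discAut`. [cite: MochizukiAbsTopIII2015, Proposition 4.2 (i) p.105] -/
theorem app_eq_id_of_obj_eq_disc (Q : ObjectProperty HolRS)
    (α : 𝟭 (geometricAutHolFieldFunctor Q).EA ≅ 𝟭 (geometricAutHolFieldFunctor Q).EA)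
    (P : (geometricAutHolFieldFunctor Q).EA) (hP : P.obj = disc) : α.hom.app P = 𝟙 P := by
  obtain ⟨X, hX⟩ := P
  subst hP
  -- naturality at a disc automorphism, read on underlying maps
  have comm : ∀ {f : ℂ → ℂ} (hf : IsDiscAut f) (z : unitDiscOpens),
      (α.hom.app ⟨disc, hX⟩).hom.toFun (discMap f hf.mapsTo z) =
        discMap f hf.mapsTo ((α.hom.app ⟨disc, hX⟩).hom.toFun z) := by
    intro f hf z
    have h := α.hom.naturality (InducedCategory.homMk (discHom hf) :
      (⟨disc, hX⟩ : (geometricAutHolFieldFunctor Q).EA) ⟶ ⟨disc, hX⟩)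
    exact congrArg (fun φ => φ.hom.toFun z) h
  have hid : (α.hom.app ⟨disc, hX⟩).hom.toFun = id := by
    refine eq_id_of_comm_discAut _ (fun z => ?_) (fun a ha z => ?_)
    · have hneg : IsDiscAut (fun w : ℂ => -w) :=
        (isDiscAut_mul (c := -1) (by simp)).congr fun w _ => by simp
      have h := congrArg (fun w : unitDiscOpens => (w : ℂ)) (comm hneg z)
      simpa using h
    · have h := congrArg (fun w : unitDiscOpens => (w : ℂ)) (comm (isDiscAut_discMobius ha) z)
      simpa using h
  apply InducedCategory.hom_ext
  exact hom_ext hid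

/-- **`EA^hol_RS` on the Aut-holomorphic disc is id-rigid**: every automorphism of the identity functor of
the full subcategory `(· = disc)` of `HolRS` is the identity. [cite: MochizukiAbsTopIII2015, Proposition 4.2 (i) p.105] -/
theorem isIdRigid_EA_disc : IsIdRigid (geometricAutHolFieldFunctor (· = disc)).EA :=
  isRigidFunctor_of_hom_app_eq_id fun α P => app_eq_id_of_obj_eq_disc _ α P P.property

/-- **Cor 4.5 (i)–(v) at the archimedean model over the Aut-holomorphic disc, UNCONDITIONALLY**
(abc-iut-L4-t10's `cor_4_5_arch` at the geometric instance `Q = (· = disc)`; the id-rigidity hypothesis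
is `isIdRigid_EA_disc`). [cite: MochizukiAbsTopIII2015, Corollary 4.5 pp.107–109] -/
theorem cor_4_5_geometric_disc :
    Literature.AnabelianGeometry.AbsoluteAnabelian.AbsTopIII.Cor_4_5
      (archLogFrobeniusData (geometricAutHolFieldFunctor (· = disc)))
      (archTelecoreData (geometricAutHolFieldFunctor (· = disc))) :=
  cor_4_5_geometric _ ⟨disc, rfl⟩ isIdRigid_EA_disc

/-- **Prop 4.2 (i), id-rigidity clause, over the disc, UNCONDITIONALLY**: `𝒞^hol_TF` and `𝒞^hol_T`
(`T ∈ {TM, TLG, TCG}`) over the geometric `EA` on `𝔻` are id-rigid.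
[cite: MochizukiAbsTopIII2015, Proposition 4.2 (i) p.105] -/
theorem isIdRigid_pairs_disc {T : ArchPairType} (hT : T.IsMonoidType) :
    IsIdRigid (HolTFPair (geometricAutHolFieldFunctor (· = disc))) ∧
      IsIdRigid (HolMonoidPair (geometricAutHolFieldFunctor (· = disc)) T) :=
  isIdRigid_pairs_of_isIdRigid_EA _ isIdRigid_EA_disc hT

end HolRS

end Literature.AnabelianGeometry.AbsoluteAnabelian

end
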